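import Summits.HodgeConjecture.HodgeConjecture.Theorems.CyclicUnitaryPowersCyclicSurfacePowersHodgeOfWeightTwoFrames
import Literature.AlgebraicGeometry.HodgeTheory.HypersurfaceFamilyTopFormFrames
import HarnessLib

/-!
# Route CyclicUnitaryPowers — the analytic K1-A and the analytic rung leaf off a MEAGRE set, UNCONDITIONAL

Support file for `stmt-HodgeConjecture-19544` (`--supports`; nothing here closes an item).  Prover seat
`hodge-nonav-20241-p1` (g17, cell hodge-nonav), brick «F-H» (the leaf) of prover-Ax's programme «B4 RELATIVE RESIDUES»
(bricks F-A … F-E, FF1 … FF4 by the seats prover-Ax g11/g12, prover-Bx g14, 20241-p1 g17).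

`CyclicUnitaryPowersGenericCyclicSurfacePowersHodge` (prover-Ax g11) proved, for every prime `p ≥ 7`, the clauses
`Deck ∧ Comm` of crux K1-A and `HodgeConjectureFor (2(k+1)) Y` for all self fibre powers `Y` of EVERY smooth projective
surface `X ⊂ ℙ³` cut out by `x₃^p − f` with `f` off a MEAGRE subset of the coefficient space `ℂ^{TernaryIndex p}` —
CONDITIONAL on the named fact `Griffiths1968_holomorphicHodgeSubbundles` (Voisin I Thm. 10.3).
`CyclicUnitaryPowersCyclicSurfacePowersHodgeOfWeightTwoFrames` (this seat) replaced that input by holomorphic frames of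
`F²𝓗² = 𝓗^{2,0}` of the Carlson–Toledo family `cyclicCoverFamily p = familySpz ℂ 2 p (cyclicCoverSpz p)` in flat
coordinates, and `exists_topFormFrame_familySpz` (`HypersurfaceFamilyTopFormFrames`, prover-Ax g12: periods of the relative
Griffiths residues `Res(PΩ/F_t)`, `d ≥ n + 2`) PROVES exactly those frames for every family `familySpz ℂ (n₀+1) d sp`.
This file applies it at `n₀ = 1`, `d = p ≥ 4`, `sp = cyclicCoverSpz p`:

* `exists_isMeagre_isHodgeGenericPoint_cyclicCoverFamily_of_four_le` — §1: for `p ≥ 4` and Hodge-symmetric fibre models, a meagre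
  set of coefficient vectors (containing `0`) off which every `f` with smooth cyclic model is Hodge generic — NO hypothesis;
* `exists_deck_comm_offMeagre` — §2: the analytic K1-A (`Deck ∧ Comm` off a meagre set, every prime `p ≥ 7`) — NO hypothesis;
* `cyclicSurfacePowersHodge_offMeagre` — §3: the analytic leaf: for every prime `p ≥ 7` a MEAGRE `M ⊆ ℂ^{TernaryIndex p}`
  such that for every `f` homogeneous of degree `p` with coefficient vector off `M`, every smooth projective surface
  `X ⊂ ℙ³` cut out by `x₃^p − f` and every `(k+1)`-fold self fibre power `Y` of `X`: `HodgeConjectureFor (2(k+1)) Y` —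
  NO hypothesis, axioms standard.

HONEST FRAMING: this is the Hodge conjecture for all powers of the members of ONE explicit countable union of families of
surfaces off a MEAGRE (not Zariski-closed, not measure-zero-certified) exceptional set of parameters; items 19544 ∕ 19543
(which ask for the complement of a countable union of proper Zariski-closed subsets, via CDK1995) stay OPEN; rung F-H1 is
not moved; nothing here says HC ∕ HC_CM ∕ HC_AV is proved.

## References
* [Griffiths1968PeriodsII] P. Griffiths, Periods of integrals on algebraic manifolds II, Amer. J. Math. 90 (1968), Thm. 1.1.
* [Griffiths1969] P. Griffiths, On the periods of certain rational integrals I, Ann. of Math. 90 (1969), §8.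
* [Deligne1972WeilK3] P. Deligne, La conjecture de Weil pour les surfaces K3, Invent. Math. 15 (1972), Prop. 7.5.
* [Andre1992] Y. André, Mumford–Tate groups of mixed Hodge structures …, Compositio Math. 82 (1992), §4 Lemma 4, §5 Thm. 1.
* [VoisinHodgeI2002] C. Voisin, Hodge Theory and Complex Algebraic Geometry I, CUP 2002, §7.1.2, §10.2.1 Thm. 10.3, §10.2.2.
* [VoisinHodgeII2003] C. Voisin, Hodge Theory and Complex Algebraic Geometry II, CUP 2003, §5.3.1 Lemma 5.13, §6.1.3, §6.2.1.
* [CarlsonToledo1999] J. A. Carlson, D. Toledo, Duke Math. J. 97 (1999), §§2, 5, 6, 7 (Thm. 7.1).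
-/

noncomputable section

set_option linter.dupNamespace false

namespace Summit.HodgeConjecture.HodgeConjecture.Theorems.CyclicUnitaryPowersGenericCyclicSurfacePowersHodge

open Literature.AlgebraicGeometry.Motives Literature.AlgebraicGeometry.HodgeTheory
open Literature.AlgebraicGeometry.HodgeTheory.BettiUniverse
open Literature.AlgebraicGeometry.Motives.UniversalHypersurface Literature.AlgebraicGeometry.HodgeTheory.UniversalHypersurface
open Literature.AlgebraicTopology.SingularHomology
open CategoryTheory CategoryTheory.Limits _root_.Topology _root_.Filter
open scoped TensorProduct
open Summit.HodgeConjecture.HodgeConjecture.Theorems.CyclicUnitaryPowersHodgeGenericDeckCommutators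
open Summit.HodgeConjecture.HodgeConjecture.Theorems.CyclicUnitaryPowersNodalMeridianMonodromy

/-! ### §1 The meagre exceptional set of coefficient vectors — unconditional -/

/-- **The meagre exceptional set of the Carlson–Toledo family, unconditionally** (§1): for `p ≥ 4` and Hodge-symmetric
fibre models `A`, there is a meagre `M ⊆ ℂ^{TernaryIndex p}`, containing `0`, off which the classifying point of every
`f` with smooth cyclic model is Hodge generic: `exists_isMeagre_isHodgeGenericPoint_cyclicCoverFamily_of_weightTwoFrames`
with its frame hypothesis `hF2` DISCHARGED by `exists_topFormFrame_familySpz 1 p (cyclicCoverSpz p)` (relative Griffiths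
residues; the continuation clause of `hF2` is not needed). [cite: Griffiths1968PeriodsII, Thm. 1.1] [cite: Griffiths1969, §8]
[cite: Deligne1972WeilK3, Prop. 7.5] [cite: VoisinHodgeII2003, §5.3.1 Lemma 5.13] [cite: CarlsonToledo1999, §2] -/
theorem exists_isMeagre_isHodgeGenericPoint_cyclicCoverFamily_of_four_le (p : ℕ) [NeZero p] (hp : 4 ≤ p)
    (A : ∀ t : ComplexPoints (cyclicCoverBase p), HodgeModel 2 (fiberOver (cyclicCoverFamily p) t))
    (hA : ∀ t, (A t).IsHodgeSymmetric) :
    ∃ M : Set (TernaryIndex p → ℂ), IsMeagre M ∧ (0 : TernaryIndex p → ℂ) ∈ M ∧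
      ∀ f : MvPolynomial (Fin 3) ℂ, f.IsHomogeneous p →
        SmoothHypersurface.IsNonsingularForm ℂ (cyclicCoverForm p f) →
        (fun d : TernaryIndex p => f.coeff d.1) ∉ M →
        haveI : HodgeTensorFacts.{0, 0} := hodgeTensorFacts_holds
        haveI : ∀ t : ComplexPoints (cyclicCoverBase p),
            Module.Finite ℚ (bettiCohomology (fiberOver (cyclicCoverFamily p) t) 2) :=
          fun t => finite ((isSmoothProjectiveFamily_cyclicCoverFamily p).isSmoothProjective t) 2
        IsHodgeGenericPoint (cyclicCoverFamily p) 2 (cyclicCoverFamily_locallyTrivial p)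
          (isSmoothProjectiveFamily_cyclicCoverFamily p) A hA ⟨cyclicCoverPoint p f, Set.mem_univ _⟩ := by
  haveI := smoothOfRelativeDimension_baseSpz_hom ℂ 2 p (cyclicCoverSpz p)
  exact exists_isMeagre_isHodgeGenericPoint_cyclicCoverFamily_of_weightTwoFrames p A hA
    fun s t₁ N hN T₁ _ => exists_topFormFrame_familySpz 1 p (cyclicCoverSpz p) (by omega)
      (0 + Nat.card (TernaryIndex p)) (isSmoothProjectiveFamily_cyclicCoverFamily p)
      (cyclicCoverFamily_locallyTrivial p) A hA s t₁ N hN T₁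

/-! ### §2 Analytic K1-A — unconditional -/

/-- **Analytic K1-A, unconditionally** (§2): for every prime `p ≥ 7` a meagre `M ⊆ ℂ^{TernaryIndex p}` such that every `f`
homogeneous of degree `p` with coefficient vector off `M` and every smooth projective `X ⊂ ℙ³` cut out by `x₃^p − f` carry
`σ : X ⟶ X` with the route's clauses `Deck ∧ Comm` (verbatim the `let`-block of the route decl `VeryGeneralDeckCommutatorsInHg`;
verbatim the conclusion of `exists_deck_comm_offMeagre_of_griffiths1968`, WITHOUT its named-fact hypothesis).
[cite: Griffiths1968PeriodsII, Thm. 1.1] [cite: Griffiths1969, §8] [cite: Deligne1972WeilK3, Prop. 7.5]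
[cite: Andre1992, §4 Lemma 4 and §5 Thm. 1] [cite: CarlsonToledo1999, §6 (kdoublept) and §7 Theorem 7.1]
[cite: VoisinHodgeII2003, §5.3.1 Lemma 5.13] -/
theorem exists_deck_comm_offMeagre :
    open Literature.AlgebraicGeometry.Motives Literature.AlgebraicGeometry.HodgeTheory Literature.AlgebraicGeometry.HodgeTheory.BettiUniverse CategoryTheory.Limits in let pmul : List ℕ → List ℕ → List ℕ := fun a b => (List.range (a.length + b.length - 1)).map fun k => ((List.range (k + 1)).map fun i => a.getD i 0 * b.getD (k - i) 0).sum; let ehn : ℕ → ℕ → ℕ → ℕ := fun p j q => if (q + 1) * p < 3 + j then 0 else ((List.replicate 3 (List.replicate (p - 1) 1)).foldl pmul [1]).getD ((q + 1) * p - 3 - j) 0; let Deck : (p : ℕ) → (X : SchemeOver ℂ) → IsSmoothProjective 2 X → (X ⟶ X) → Prop := fun p X hX σ => pull σ 2 ^ p = 1 ∧ (∀ x y, tr hX (2 + 2) (cup X 2 2 (pull σ 2 x) (pull σ 2 y)) = tr hX (2 + 2) (cup X 2 2 x y)) ∧ Module.finrank ℚ ↥(Module.End.eigenspace (pull σ 2)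 1) = 1 ∧ ∃ ζ : ℂ, IsPrimitiveRoot ζ p ∧ ∀ j q : ℕ, 1 ≤ j → j < p → q ≤ 2 → Module.finrank ℂ ↥(Module.End.eigenspace ((pull σ 2).baseChange ℂ) (ζ ^ j) ⊓ (hodge exists_isReal_hodgeModel_holds hX 2).piece ((2 : ℤ) - q) q) = ehn p j q; let Uni : (X : SchemeOver ℂ) → IsSmoothProjective 2 X → (X ⟶ X) → (bettiCohomology X 2 ≃ₗ[ℚ] bettiCohomology X 2) → Prop := fun X hX σ g => (∀ x, g (pull σ 2 x) = pull σ 2 (g x)) ∧ ∀ x y, tr hX (2 + 2) (cup X 2 2 (g x) (g y)) = tr hX (2 + 2) (cup X 2 2 x y); let Comm : (X : SchemeOver ℂ) → IsSmoothProjective 2 X → (X ⟶ X) → Prop := fun X hX σ => haveI := finite hX 2; haveI : HodgeTensorFacts.{0, 0} := hodgeTensorFacts_holds; ∀ g h : bettiCohomology X 2 ≃ₗ[ℚ] bettiCohomology X 2, Uni X hX σ g → Uni X hX σ h → g * h * g⁻¹ * h⁻¹ ∈ (hodge exists_isReal_hodgeModel_holds hX 2).hodgeGroup; ∀ ⦃p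 : ℕ⦄, p.Prime → 7 ≤ p → ∃ M : Set ({d : Fin 3 →₀ ℕ // d.degree = p} → ℂ), IsMeagre M ∧ ∀ f : MvPolynomial (Fin 3) ℂ, f.IsHomogeneous p → (fun d : {d : Fin 3 →₀ ℕ // d.degree = p} => f.coeff d.1) ∉ M → ∀ ⦃X : SchemeOver ℂ⦄ (hX : IsSmoothProjective 2 X), IsHypersurfaceCutOutBy 3 (MvPolynomial.X (Fin.last 3) ^ p - MvPolynomial.rename Fin.castSucc f) X → ∃ σ : X ⟶ X, Deck p X hX σ ∧ Comm X hX σ := by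
  intro pmul ehn Deck Uni Comm p hp h7
  haveI : NeZero p := ⟨hp.ne_zero⟩
  have hp2 : 2 ≤ p := by omega
  -- real (hence Hodge-symmetric) Hodge models of the fibres of the Carlson–Toledo family
  have hAm := fun t : ComplexPoints (cyclicCoverBase p) =>
    exists_isReal_hodgeModel_holds.exists_isHodgeSymmetric
      ((isSmoothProjectiveFamily_cyclicCoverFamily p).isSmoothProjective t)
  let A : ∀ t : ComplexPoints (cyclicCoverBase p), HodgeModel 2 (fiberOver (cyclicCoverFamily p) t) :=
    fun t => (hAm t).choose
  have hA : ∀ t, (A t).IsHodgeSymmetric := fun t => (hAm t).choose_spec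
  obtain ⟨M, hM, h0M, hgen⟩ := exists_isMeagre_isHodgeGenericPoint_cyclicCoverFamily_of_four_le p (by omega) A hA
  refine ⟨M, hM, fun f hf hfM X hX hcut => ?_⟩
  have hf0 : f ≠ 0 := by
    intro h
    apply hfM
    have : (fun d : TernaryIndex p => f.coeff d.1) = 0 := funext fun d => by rw [h, MvPolynomial.coeff_zero]; rfl
    rw [this]
    exact h0M
  obtain ⟨e⟩ := hcut.nonempty_iso_hypersurface
  have hXF : IsSmoothProjective 2 (SmoothHypersurface.hypersurface
      (MvPolynomial.X (Fin.last 3) ^ p - MvPolynomial.rename Fin.castSucc f)) := hX.of_iso e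
  have hJ : SmoothHypersurface.IsNonsingularForm ℂ (cyclicCoverForm p f) :=
    CyclicCoverFormNonsingular.isNonsingularForm_cyclicCoverForm_of_isSmoothProjective hp2 hf hf0 hXF
  exact exists_deck_comm_of_hodgeGeneric_of_localMonodromyBound
    carlsonToledo1999_nodalMeridianLocalMonodromyBound_holds hp h7 f hf hf0 hXF A hA (hgen f hf hJ hfM) hX hcut

/-! ### §3 The analytic leaf — unconditional -/

/-- **Analytic rung-F-H1 leaf, unconditionally** (§3): for every prime `p ≥ 7` a MEAGRE subset `M` of the coefficient
space `ℂ^{TernaryIndex p}` such that for every `f` homogeneous of degree `p` with coefficient vector off `M`, every smooth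
projective surface `X ⊂ ℙ³` cut out by `x₃^p − f` and every `(k+1)`-fold self fibre power `Y` of `X`:
`HodgeConjectureFor (2(k+1)) Y` (verbatim the conclusion of `cyclicSurfacePowersHodge_offMeagre_of_griffiths1968`, WITHOUT
its named-fact hypothesis: Griffiths' holomorphy of `F²` is supplied by the relative residues of
`exists_topFormFrame_familySpz`).  Items 19544 ∕ 19543 stay open (they ask for a countable union of proper Zariski-closed
exceptional sets); rung F-H1 not moved; HC not proved. [cite: Griffiths1968PeriodsII, Thm. 1.1] [cite: Griffiths1969, §8]
[cite: Deligne1972WeilK3, Prop. 7.5] [cite: Andre1992, §4 Lemma 4 and §5 Thm. 1]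
[cite: CarlsonToledo1999, §6 (kdoublept) and §7 Theorem 7.1] [cite: VoisinHodgeII2003, §5.3.1 Lemma 5.13] -/
theorem cyclicSurfacePowersHodge_offMeagre :
    ∀ ⦃p : ℕ⦄, p.Prime → 7 ≤ p → ∃ M : Set ({d : Fin 3 →₀ ℕ // d.degree = p} → ℂ), IsMeagre M ∧
      ∀ f : MvPolynomial (Fin 3) ℂ, f.IsHomogeneous p →
        (fun d : {d : Fin 3 →₀ ℕ // d.degree = p} => f.coeff d.1) ∉ M →
        ∀ ⦃X : SchemeOver ℂ⦄, IsSmoothProjective 2 X →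
          IsHypersurfaceCutOutBy 3 (MvPolynomial.X (Fin.last 3) ^ p - MvPolynomial.rename Fin.castSucc f) X →
          ∀ ⦃k : ℕ⦄ ⦃Y : SchemeOver ℂ⦄, (∃ π : Fin (k + 1) → (Y ⟶ X), Nonempty (IsLimit (Fan.mk Y π))) →
            HodgeConjectureFor (2 * (k + 1)) Y := by
  intro p hp h7
  haveI : NeZero p := ⟨hp.ne_zero⟩
  have hp2 : 2 ≤ p := by omega
  have hAm := fun t : ComplexPoints (cyclicCoverBase p) =>
    exists_isReal_hodgeModel_holds.exists_isHodgeSymmetric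
      ((isSmoothProjectiveFamily_cyclicCoverFamily p).isSmoothProjective t)
  let A : ∀ t : ComplexPoints (cyclicCoverBase p), HodgeModel 2 (fiberOver (cyclicCoverFamily p) t) :=
    fun t => (hAm t).choose
  have hA : ∀ t, (A t).IsHodgeSymmetric := fun t => (hAm t).choose_spec
  obtain ⟨M, hM, h0M, hgen⟩ := exists_isMeagre_isHodgeGenericPoint_cyclicCoverFamily_of_four_le p (by omega) A hA
  refine ⟨M, hM, fun f hf hfM X hX hcut k Y hY => ?_⟩
  have hf0 : f ≠ 0 := by
    intro h
    apply hfM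
    have : (fun d : TernaryIndex p => f.coeff d.1) = 0 := funext fun d => by rw [h, MvPolynomial.coeff_zero]; rfl
    rw [this]
    exact h0M
  obtain ⟨e⟩ := hcut.nonempty_iso_hypersurface
  have hXF : IsSmoothProjective 2 (SmoothHypersurface.hypersurface
      (MvPolynomial.X (Fin.last 3) ^ p - MvPolynomial.rename Fin.castSucc f)) := hX.of_iso e
  have hJ : SmoothHypersurface.IsNonsingularForm ℂ (cyclicCoverForm p f) :=
    CyclicCoverFormNonsingular.isNonsingularForm_cyclicCoverForm_of_isSmoothProjective hp2 hf hf0 hXF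
  exact hodgeConjectureFor_powers_of_hodgeGeneric_of_localMonodromyBound
    carlsonToledo1999_nodalMeridianLocalMonodromyBound_holds hp h7 f hf hf0 hXF A hA (hgen f hf hJ hfM) hX hcut hY

end Summit.HodgeConjecture.HodgeConjecture.Theorems.CyclicUnitaryPowersGenericCyclicSurfacePowersHodge

end
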